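import Summits.BirchSwinnertonDyer.BirchSwinnertonDyer.Theorems.GenusKolyvaginAtTwoTorsionCellSELBorderedAlgebra
import Mathlib.LinearAlgebra.Dual.Lemmas
import HarnessLib

/-!
# SEL (iso-class Selmer pair law), C1-B: `𝟙` and `π` are in the image of `Φ₃(B)`; the transfer bits `f, g`

Crux R″ `RankOneTwoTorsionResidualAtTwo` (stmt-27478), LINE 49 «full_vertex», SUPPORT stub SEL
`IsoClassSelmerPairLawAtTwo`, the `C₁` conjunct (LEAD memo `Cruxes/…/Lines/torsion_cell_full_vertex_SEL_C1_road_g36.md`, §4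
brick (IM)).  With `B = borderedLaplacian Q p₀`, `Φ = Φ₃(B)`, `π j = legendreBit (−p₀) j`:

* `exists_mulVec_eq_of_forall_vecMul` — the half of the Fredholm alternative we need, for any square matrix over a
  field: a vector orthogonal to `ker Aᵀ` is in the image of `A` (Mathlib's `range_dualMap_eq_dualAnnihilator_ker`).
* `exists_phi3_mulVec_eq_const` / `exists_phi3_mulVec_eq_border` — **`𝟙, π ∈ im Φ₃(B)`** (the transposed K-lemma of
  part C1-A says `𝟙, π ⊥ ker Φ₃(B)ᵀ`).
* `phi3_transfer_relations` — for any preimages `Φw₁ = 𝟙`, `Φw_π = π`, the four bits `F₁₁ = 𝟙ᵀw₁`, `g = πᵀw₁`,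
  `f = 𝟙ᵀw_π`, `F_ππ = πᵀw_π` satisfy **`F₁₁ = F_ππ = f + g` and `f·g = 0`** (so `(f, g) ∈ {(0,0), (1,0), (0,1)}`;
  `F₁₁ = 𝟙ᵀΦ₃(B)⁻¹𝟙` is the pen's F9c scalar-law bit).

Everything is proved; no LINE 49 statement is restated; BSD is not advanced by this file alone.

## References

* [HeathBrown1994SelmerCongruentII] D. R. Heath-Brown, Invent. Math. 118 (1994), §2 (Laplacian/tournament linear algebra).
* [Kane2013SelmerTwists] D. M. Kane, Algebra Number Theory 7 (2013), §2.
-/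

namespace Summit.BirchSwinnertonDyer.BirchSwinnertonDyer.Theorems.GenusKolyvaginAtTwo.FullVertex

open Matrix

/-! ## Orthogonal to `ker Aᵀ` ⇒ in the image of `A` -/

/-- **Half of the Fredholm alternative** over a field: if `y ⬝ v = 0` for every `y` with `yᵀA = 0`, then `v = Aw` for
some `w`. [folklore] -/
theorem exists_mulVec_eq_of_forall_vecMul {n K : Type*} [Fintype n] [DecidableEq n] [Field K] (A : Matrix n n K)
    (v : n → K) (hv : ∀ y : n → K, y ᵥ* A = 0 → y ⬝ᵥ v = 0) : ∃ w : n → K, A *ᵥ w = v := by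
  classical
  let f : (n → K) →ₗ[K] (n → K) := Aᵀ.mulVecLin
  let φ : Module.Dual K (n → K) := ∑ i : n, v i • LinearMap.proj i
  have hφapp : ∀ y : n → K, φ y = v ⬝ᵥ y := by
    intro y
    simp only [φ, LinearMap.coe_sum, Finset.sum_apply, LinearMap.smul_apply, LinearMap.coe_proj, Function.eval,
      smul_eq_mul, dotProduct]
  have hφ : φ ∈ (LinearMap.ker f).dualAnnihilator := by
    rw [Submodule.mem_dualAnnihilator]
    intro y hy
    rw [LinearMap.mem_ker] at hy
    have hy' : y ᵥ* A = 0 := by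
      rw [← Matrix.mulVec_transpose]; exact hy
    rw [hφapp, dotProduct_comm]
    exact hv y hy'
  rw [← LinearMap.range_dualMap_eq_dualAnnihilator_ker] at hφ
  obtain ⟨ψ, hψ⟩ := hφ
  let w : n → K := fun i => ψ (fun j => if i = j then 1 else 0)
  have hψapp : ∀ z : n → K, ψ z = z ⬝ᵥ w := by
    intro z
    rw [LinearMap.pi_apply_eq_sum_univ ψ z]
    simp only [dotProduct, smul_eq_mul, w]
  refine ⟨w, ?_⟩
  have key : ∀ y : n → K, y ⬝ᵥ (A *ᵥ w) = y ⬝ᵥ v := by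
    intro y
    have e := LinearMap.congr_fun hψ y
    rw [LinearMap.dualMap_apply, hφapp, hψapp] at e
    -- `e : (Aᵀ *ᵥ y) ⬝ᵥ w = v ⬝ᵥ y`
    rw [Matrix.dotProduct_mulVec, dotProduct_comm y v, ← e]
    change (y ᵥ* A) ⬝ᵥ w = (Aᵀ *ᵥ y) ⬝ᵥ w
    rw [Matrix.mulVec_transpose]
  ext i
  have h := key (Pi.single i 1)
  rwa [single_dotProduct, single_dotProduct, one_mul, one_mul] at h

/-- `𝔽₂`: `2 = 0`. [folklore] -/
private theorem zmod2_two' : (2 : ZMod 2) = 0 := by decide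

/-- `𝔽₂`: `x² = x`. [folklore] -/
private theorem zmod2_mul_self' (x : ZMod 2) : x * x = x := by revert x; decide

/-- `𝔽₂`: `s = f + (s + g + P) ⇒ P = f + g`. [folklore] -/
private theorem zmod2_solveP (s f g P : ZMod 2) (h : s = f + (s + g + P)) : P = f + g := by
  revert s f g P; decide

/-- `𝔽₂`: the final elimination `f = g + f g + F`, `F = f + g` ⇒ `f g = 0`. [folklore] -/
private theorem zmod2_fg (f g F : ZMod 2) (h1 : F = f + g) (h2 : f = g + f * g + F) : f * g = 0 := by
  revert f g F; decide

variable (Q : Finset ℕ) (p₀ : ℕ) (hQ : ∀ q ∈ Q, q.Prime) (hQ4 : ∀ q ∈ Q, q % 4 = 3) (hk : Even Q.card)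
include hQ hQ4 hk

/-! ## `𝟙, π ∈ im Φ₃(B)` -/

/-- **`𝟙 ∈ im Φ₃(B)`**. [cite: HeathBrown1994SelmerCongruentII, §2] -/
theorem exists_phi3_mulVec_eq_const : ∃ w : Q → ZMod 2, phi3 (borderedLaplacian Q p₀) *ᵥ w = fun _ => 1 := by
  refine exists_mulVec_eq_of_forall_vecMul _ _ fun y hy => ?_
  have h := (sum_eq_zero_of_phi3_transpose Q p₀ hQ hQ4 hk (y := y) fun j => ?_).1
  · simpa [dotProduct] using h
  · have := congr_fun hy j
    simpa [Matrix.vecMul, dotProduct] using this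

/-- **`π ∈ im Φ₃(B)`**. [cite: HeathBrown1994SelmerCongruentII, §2] -/
theorem exists_phi3_mulVec_eq_border :
    ∃ w : Q → ZMod 2, phi3 (borderedLaplacian Q p₀) *ᵥ w = fun j : Q => legendreBit (-(p₀ : ℤ)) (j : ℕ) := by
  refine exists_mulVec_eq_of_forall_vecMul _ _ fun y hy => ?_
  have h := (sum_eq_zero_of_phi3_transpose Q p₀ hQ hQ4 hk (y := y) fun j => ?_).2
  · rw [dotProduct]
    rw [← h]
    exact Finset.sum_congr rfl fun j _ => mul_comm _ _
  · have := congr_fun hy j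
    simpa [Matrix.vecMul, dotProduct] using this

/-! ## The transfer bits -/

/-- **The transfer bits**: for preimages `Φ₃(B)w₁ = 𝟙` and `Φ₃(B)w_π = π`, with `F₁₁ = Σ w₁`, `g = Σ π w₁`,
`f = Σ w_π`, `F_ππ = Σ π w_π`: `F₁₁ = F_ππ`, `F₁₁ = f + g`, and `f · g = 0`.
[cite: HeathBrown1994SelmerCongruentII, §2] -/
theorem phi3_transfer_relations {w₁ wπ : Q → ZMod 2} (h₁ : phi3 (borderedLaplacian Q p₀) *ᵥ w₁ = fun _ => 1)
    (hπ : phi3 (borderedLaplacian Q p₀) *ᵥ wπ = fun j : Q => legendreBit (-(p₀ : ℤ)) (j : ℕ)) :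
    (∑ j : Q, w₁ j = ∑ j : Q, legendreBit (-(p₀ : ℤ)) (j : ℕ) * wπ j) ∧
    (∑ j : Q, w₁ j = ∑ j : Q, wπ j + ∑ j : Q, legendreBit (-(p₀ : ℤ)) (j : ℕ) * w₁ j) ∧
    (∑ j : Q, wπ j) * (∑ j : Q, legendreBit (-(p₀ : ℤ)) (j : ℕ) * w₁ j) = 0 := by
  set F := ∑ j : Q, w₁ j with hF
  set g := ∑ j : Q, legendreBit (-(p₀ : ℤ)) (j : ℕ) * w₁ j with hg
  set f := ∑ j : Q, wπ j with hf
  set P := ∑ j : Q, legendreBit (-(p₀ : ℤ)) (j : ℕ) * wπ j with hP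
  have hkz : ((Q.card : ℕ) : ZMod 2) = 0 := by
    obtain ⟨r, hr⟩ := hk
    rw [hr, ← two_mul, Nat.cast_mul, Nat.cast_two, zmod2_two', zero_mul]
  -- K-lemma on differences of preimages
  have hdiff : ∀ {x x' : Q → ZMod 2}, phi3 (borderedLaplacian Q p₀) *ᵥ x = phi3 (borderedLaplacian Q p₀) *ᵥ x' →
      (∑ j : Q, x j = ∑ j : Q, x' j) ∧
        (∑ j : Q, legendreBit (-(p₀ : ℤ)) (j : ℕ) * x j = ∑ j : Q, legendreBit (-(p₀ : ℤ)) (j : ℕ) * x' j) := by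
    intro x x' hxx'
    have hker : phi3 (borderedLaplacian Q p₀) *ᵥ (x - x') = 0 := by rw [mulVec_sub, hxx', sub_self]
    have h := sum_eq_zero_of_phi3_mulVec_eq_zero Q p₀ hQ hQ4 hk hker
    simp only [Pi.sub_apply, Finset.sum_sub_distrib, mul_sub] at h
    exact ⟨sub_eq_zero.mp h.1, sub_eq_zero.mp h.2⟩
  -- (i) `Bw₁` is a preimage of `π`: `πᵀBw₁ = P`
  have hBw₁ : phi3 (borderedLaplacian Q p₀) *ᵥ (borderedLaplacian Q p₀ *ᵥ w₁) = phi3 (borderedLaplacian Q p₀) *ᵥ wπ := by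
    rw [phi3_mulVec_mulVec, h₁, borderedLaplacian_mulVec_const, hπ]; ext j; rw [one_mul]
  have hi := (hdiff hBw₁).2
  -- (A3) at `w₁`: `Σ 1 = F + πᵀBw₁`
  have hA3₁ := sum_phi3_mulVec_eq Q p₀ hQ hQ4 hk w₁
  rw [h₁, Finset.sum_const, Finset.card_univ, Fintype.card_coe, nsmul_eq_mul, mul_one, hkz, hi, ← hF, ← hP] at hA3₁
  have hFP : F = P := by
    have : F + P = 0 := hA3₁.symm
    calc F = F + P + P := by rw [add_assoc, CharTwo.add_self_eq_zero, add_zero]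
      _ = P := by rw [this, zero_add]
  -- (ii) `Bw_π` is a preimage of `Bπ = Φ𝟙 + 𝟙 + π = Φ(𝟙 + w₁ + w_π)`
  have hBwπ : phi3 (borderedLaplacian Q p₀) *ᵥ (borderedLaplacian Q p₀ *ᵥ wπ) =
      phi3 (borderedLaplacian Q p₀) *ᵥ ((fun _ => (1 : ZMod 2)) + w₁ + wπ) := by
    rw [phi3_mulVec_mulVec, hπ, mulVec_add, mulVec_add, h₁, hπ, phi3_mulVec, borderedLaplacian_mulVec_const]
    ext j
    simp only [Pi.add_apply, one_mul]
    linear_combination (-(1 + legendreBit (-(p₀ : ℤ)) (j : ℕ))) * zmod2_two'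
  have hii := (hdiff hBwπ).2
  have hA3π := sum_phi3_mulVec_eq Q p₀ hQ hQ4 hk wπ
  rw [hπ, hii, ← hf] at hA3π
  simp only [Pi.add_apply, mul_add, Finset.sum_add_distrib, mul_one] at hA3π
  rw [← hg, ← hP] at hA3π
  -- `hA3π : Σπ = f + (Σπ + g + P)` ⇒ `P = f + g`
  have hfgP : F = f + g := hFP.trans (zmod2_solveP _ _ _ _ hA3π)
  refine ⟨hFP, hfgP, ?_⟩
  -- (iii) `w_πᵀ Φ w₁` two ways
  have hcol : ∑ j : Q, wπ j * (phi3 (borderedLaplacian Q p₀) *ᵥ w₁) j =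
      ∑ i : Q, w₁ i * (∑ j : Q, wπ j * phi3 (borderedLaplacian Q p₀) j i) := by
    simp only [mulVec, dotProduct, Finset.mul_sum]
    rw [Finset.sum_comm]
    exact Finset.sum_congr rfl fun i _ => Finset.sum_congr rfl fun j _ => by ring
  have hlhs : ∑ j : Q, wπ j * (phi3 (borderedLaplacian Q p₀) *ᵥ w₁) j = f := by
    rw [h₁]; simp only [mul_one]; rfl
  have hrow : ∀ i : Q, ∑ j : Q, wπ j * phi3 (borderedLaplacian Q p₀) j i =
      legendreBit (-(p₀ : ℤ)) (i : ℕ) + f * legendreBit (-(p₀ : ℤ)) (i : ℕ) + P := by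
    intro i; rw [sum_mul_phi3_col Q p₀ hQ hQ4 hk wπ i, hπ]
  have hrhs : ∑ i : Q, w₁ i * (∑ j : Q, wπ j * phi3 (borderedLaplacian Q p₀) j i) = g + f * g + P * F := by
    rw [Finset.sum_congr rfl fun i _ => by rw [hrow i]]
    simp only [mul_add, Finset.sum_add_distrib]
    have e1 : ∑ i : Q, w₁ i * legendreBit (-(p₀ : ℤ)) (i : ℕ) = g := by
      rw [hg]; exact Finset.sum_congr rfl fun i _ => mul_comm _ _
    have e2 : ∑ i : Q, w₁ i * (f * legendreBit (-(p₀ : ℤ)) (i : ℕ)) = f * g := by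
      rw [hg, Finset.mul_sum]; exact Finset.sum_congr rfl fun i _ => by ring
    have e3 : ∑ i : Q, w₁ i * P = P * F := by rw [← Finset.sum_mul, ← hF, mul_comm]
    rw [e1, e2, e3]
  have hmain : f = g + f * g + F := by
    have e := hlhs.symm.trans (hcol.trans hrhs)
    rwa [← hFP, zmod2_mul_self'] at e
  exact zmod2_fg f g F hfgP hmain

end Summit.BirchSwinnertonDyer.BirchSwinnertonDyer.Theorems.GenusKolyvaginAtTwo.FullVertex
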